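import Literature.AlgebraicGeometry.Modules.GrothendieckComplexKernelRepr
import HarnessLib

/-!
# Naturality of the kernel representation of the Grothendieck complex in the affine test object
# (Görtz–Wedhorn II, Cor. 23.135 / (23.28.5); Mumford, *Abelian Varieties*, §5, Cor. 2)

For a morphism `k : T'' → T'` of affine test objects over the affine base `T` (`k ≫ j' = j''`,
`Modules/AffineTestObjects`), the kernel representations
`θ' : Γ(P ×_K T', g'^*L) ≃ ker(d ⊗_A B')` and `θ'' : Γ(P ×_K T'', g''^*L) ≃ ker(d ⊗_A B'')` of
`Modules/GrothendieckComplexKernelRepr` form a commutative square with the pull-back of sections `η_k`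
(`Modules.pullSec`, through `(1 × k)^* g'^*L ≅ g''^*L`) on the left and `k♯ ⊗ 1 : K⁰ ⊗ B' → K⁰ ⊗ B''` on the
right: **`Modules.kernelReprEquiv_natural`**. The proof is the cochain-level identity
`(Θ'' ⊗ 1) ∘ (k♯ ⊗ 1) = η_k ∘ (Θ' ⊗ 1)` on `B' ⊗_A Č⁰(𝓥, L)` (`Modules.cochainBC_rTensor`), reduced to pure
tensors `b ⊗ m` where it is the composition law of unit sections `η_k(η_{j'}(m))| = η_{j''}(m)|`
(`Modules.pullSecLE_unitSectionLE`, ★ `pullbackComp_hom_app_unitSection`) and the `B'`-semilinearity of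
`η_k` (`pullSecLE_smul`). This is the functoriality in the test object of the isomorphism of Görtz–Wedhorn II,
Cor. 23.135 / (23.28.5) (Mumford §5, Cor. 2: "the Grothendieck complex represents the functor
`B ↦ H⁰(X_B, L_B)` on `A`-algebras"). Everything is proved; no named facts. Mathlib searched (pin):
`TensorProduct.induction_on`, `LinearMap.rTensor`, `Scheme.Hom.appLE_comp_appLE` (used).
Cell `hodgecm-mathlib`, M13 node N1 (1b) (B-p10 (g8), cut/couriered by B-p15 (g8) per B-plan1 R140/R142);
generic, books 0.

## References

* U. Görtz, T. Wedhorn, *Algebraic Geometry II: Cohomology of Schemes* (2023),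
  doi:10.1007/978-3-658-43031-3: Cor. 23.135 (p. 355), (23.28.5). [GortzWedhorn2023]
* D. Mumford, *Abelian Varieties*, TIFR Studies in Mathematics 5 (1970), §5, Cor. 2 (p. 50). [MumfordAV1970]
-/

universe u

open CategoryTheory CategoryTheory.Limits AlgebraicGeometry TopologicalSpace Opposite MonoidalCategory
open CartesianMonoidalCategory TensorProduct
open Literature.AlgebraicGeometry.Motives Literature.Algebra.Homology

set_option backward.isDefEq.respectTransparency false

noncomputable section

namespace Literature.AlgebraicGeometry.Modules

section Naturality

variable {K : Type u} [Field K] (P T : SchemeOver K) [IsAffine T.left]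
variable {ι : Type} [LinearOrder ι] [Fintype ι] (𝓥 : ι → (P ⊗ T).left.Opens) (L : (P ⊗ T).left.Modules)
variable (hV : ∀ s : Finset ι, s.Nonempty → IsAffineOpen (cechOpen 𝓥 s)) (hcov : ⨆ i, 𝓥 i = ⊤)
variable {T' T'' : SchemeOver K} [IsAffine T'.left] [IsAffine T''.left] (j' : T' ⟶ T) (j'' : T'' ⟶ T)
  (k : T'' ⟶ T') (hk : k ≫ j' = j'')

omit [IsAffine T.left] [IsAffine T'.left] [IsAffine T''.left] in
set_option maxHeartbeats 800000 in
/-- **THE COMPOSITION LAW `η_k(η_{j'}(m))| = η_{j''}(m)|`** through `testModCompIso` (★ `pullbackComp_hom_app_unitSection`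
+ ★ `pullbackCongr_hom_app_unitSection`, restricted). [folklore] [cite: GortzWedhorn2023, Cor. 23.135 (p. 355)] -/
theorem pullSecLE_unitSectionLE {V : (P ⊗ T).left.Opens} {V' : (P ⊗ T').left.Opens} {V'' : (P ⊗ T'').left.Opens}
    (h' : V' ≤ testMap P T j' ⁻¹ᵁ V) (h'' : V'' ≤ testMap P T j'' ⁻¹ᵁ V) (hk'' : V'' ≤ testMap P T' k ⁻¹ᵁ V')
    (m : SecMod L (baseToTotal P T) V) :
    pullSecLE P T L j' j'' k hk hk'' (SecMod.mk (unitSectionLE (testMap P T j') L h' (SecMod.val m))) =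
      SecMod.mk (unitSectionLE (testMap P T j'') L h'' (SecMod.val m)) := by
  apply SecMod.val_injective (ρ := baseToTotal P T'')
  rw [val_pullSecLE]
  change ((testModCompIso P T L j' j'' k hk).hom.app V'')
      (unitSectionLE (testMap P T' k) (testMod P T j' L) hk'' (unitSectionLE (testMap P T j') L h' (SecMod.val m))) =
    unitSectionLE (testMap P T j'') L h'' (SecMod.val m)
  -- move all restrictions outside
  have e1 : unitSectionLE (testMap P T' k) (testMod P T j' L) hk'' (unitSectionLE (testMap P T j') L h' (SecMod.val m)) =
      ((Scheme.Modules.pullback (testMap P T' k)).obj (testMod P T j' L)).presheaf.map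
        (homOfLE hk'' ≫ (Opens.map (testMap P T' k).base).map (homOfLE h')).op
        (unitSection (testMap P T' k) (testMod P T j' L) (testMap P T j' ⁻¹ᵁ V)
          (unitSection (testMap P T j') L V (SecMod.val m))) := by
    rw [unitSectionLE, unitSectionLE, unitSection_map, ← CategoryTheory.comp_apply, ← Functor.map_comp]
    rfl
  rw [e1, Scheme.Modules.Hom.app_map_apply]
  -- the composition law on full preimages
  have hcomp : ((testModCompIso P T L j' j'' k hk).hom.app (testMap P T' k ⁻¹ᵁ (testMap P T j' ⁻¹ᵁ V)))
      (unitSection (testMap P T' k) (testMod P T j' L) (testMap P T j' ⁻¹ᵁ V) (unitSection (testMap P T j') L V (SecMod.val m))) =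
      (testMod P T j'' L).presheaf.map
        (eqToHom (by rw [← Scheme.Hom.comp_preimage, testMap_comp P T j' j'' k hk])).op
        (unitSection (testMap P T j'') L V (SecMod.val m)) := by
    have step1 := pullbackComp_hom_app_unitSection (testMap P T j') L (testMap P T' k) V (SecMod.val m)
    have step2 := pullbackCongr_hom_app_unitSection L (testMap_comp P T j' j'' k hk) V (SecMod.val m)
    change ((Scheme.Modules.pullbackCongr (testMap_comp P T j' j'' k hk)).hom.app L).app _
        (((Scheme.Modules.pullbackComp (testMap P T' k) (testMap P T j')).hom.app L).app _
          (unitSection (testMap P T' k) (testMod P T j' L) (testMap P T j' ⁻¹ᵁ V)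
            (unitSection (testMap P T j') L V (SecMod.val m)))) = _
    rw [step1]
    exact step2
  rw [hcomp]
  rw [← CategoryTheory.comp_apply, ← Functor.map_comp, ← op_comp, unitSectionLE]
  exact presheaf_map_congr' _ _ _ _

omit [IsAffine T.left] [IsAffine T'.left] [IsAffine T''.left] in
/-- **`pullSecLE` is `k♯`-semilinear**: `η_k(b • x) = k♯(b) • η_k(x)` for the module structures through `pr_{T'}♯`,
`pr_{T''}♯`. [folklore] [cite: GortzWedhorn2023, Cor. 23.135 (p. 355)] -/
theorem pullSecLE_smul {V' : (P ⊗ T').left.Opens} {V'' : (P ⊗ T'').left.Opens} (h : V'' ≤ testMap P T' k ⁻¹ᵁ V')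
    (b : Γ(T'.left, ⊤)) (x : SecMod (testMod P T j' L) (baseToTotal P T') V') :
    pullSecLE P T L j' j'' k hk h (b • x) = testRingHom T' k b • pullSecLE P T L j' j'' k hk h x := by
  apply SecMod.val_injective (ρ := baseToTotal P T'')
  rw [val_pullSecLE, SecMod.smul_def, SecMod.smul_def, val_pullSecLE, unitSectionLE_smul, Scheme.Modules.Hom.app_smul]
  congr 1
  rw [toSections_baseToTotal, toSections_baseToTotal]
  change ((snd P T').left.appLE ⊤ V' le_top ≫ (testMap P T' k).appLE V' V'' h) b =
    (k.left.appLE ⊤ ⊤ le_top ≫ (snd P T'').left.appLE ⊤ V'' le_top) b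
  rw [Scheme.Hom.appLE_comp_appLE, Scheme.Hom.appLE_comp_appLE]
  have hsq : testMap P T' k ≫ (snd P T').left = (snd P T'').left ≫ k.left := by
    rw [testMap, ← Over.comp_left, whiskerLeft_snd, Over.comp_left]
  have key : ∀ (f₁ f₂ : (P ⊗ T'').left ⟶ T'.left) (_ : f₁ = f₂) (h₁ : V'' ≤ f₁ ⁻¹ᵁ ⊤) (h₂ : V'' ≤ f₂ ⁻¹ᵁ ⊤),
      f₁.appLE ⊤ V'' h₁ = f₂.appLE ⊤ V'' h₂ := by
    intro f₁ f₂ e h₁ h₂; subst e; rfl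
  rw [key _ _ hsq _ le_top]

omit [IsAffine T.left] [IsAffine T'.left] [IsAffine T''.left] in
/-- `pullSecLE 0 = 0`. [folklore] [cite: GortzWedhorn2023, Cor. 23.135 (p. 355)] -/
theorem pullSecLE_zero {V' : (P ⊗ T').left.Opens} {V'' : (P ⊗ T'').left.Opens} (h : V'' ≤ testMap P T' k ⁻¹ᵁ V') :
    pullSecLE P T L j' j'' k hk h (0 : SecMod (testMod P T j' L) (baseToTotal P T') V') = 0 := by
  rw [← zero_smul Γ(T'.left, ⊤) (0 : SecMod (testMod P T j' L) (baseToTotal P T') V'), pullSecLE_smul, map_zero,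
    zero_smul]

omit [Fintype ι] in
set_option maxHeartbeats 800000 in
/-- **KEY COCHAIN LEMMA**: on degree-`0` cochains, `(Θ'' ⊗ 1) ∘ (u ⊗ 1) = η_k ∘ (Θ' ⊗ 1)` componentwise, where
`u = k♯ : B' → B''`. [folklore] [cite: GortzWedhorn2023, Cor. 23.135 (p. 355)] -/
theorem cochainBC_rTensor (hL : IsFiniteLocallyFree L)
    (w : letI := testAlgebra T j'
      Γ(T'.left, ⊤) ⊗[Γ(T.left, ⊤)] OrderedCech.SysCochain (sectionsSystem 𝓥 L (baseToTotal P T)) 0)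
    (σ : OrderedCech.Simplex ι 0) :
    letI := testAlgebra T j'; letI := testAlgebra T j''
    cochainBC P T j'' 𝓥 L hV hL 0 ((testAlgHom T j' j'' k hk).toLinearMap.rTensor _ w) σ =
      pullSecLE P T L j' j'' k hk (cechOpen_testCover_le P T 𝓥 j' j'' k hk σ.1) (cochainBC P T j' 𝓥 L hV hL 0 w σ) := by
  letI := testAlgebra T j'; letI := testAlgebra T j''
  induction w using TensorProduct.induction_on with
  | zero =>
    rw [map_zero, map_zero, map_zero, OrderedCech.SysCochain.zero_apply', OrderedCech.SysCochain.zero_apply',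
      pullSecLE_zero]
  | tmul b g =>
    have key : ∀ m : SecMod L (baseToTotal P T) (cechOpen 𝓥 σ.1),
        testThetaFamily P T j'' 𝓥 L hV hL σ.1 m =
          pullSecLE P T L j' j'' k hk (cechOpen_testCover_le P T 𝓥 j' j'' k hk σ.1)
            (testThetaFamily P T j' 𝓥 L hV hL σ.1 m) := by
      intro m
      rw [testThetaFamily, dif_pos σ.2.1, testThetaFamily, dif_pos σ.2.1, testTheta_apply, testTheta_apply,
        testTensorEquiv_tmul, testTensorEquiv_tmul, one_smul, one_smul,
        pullSecLE_unitSectionLE P T L j' j'' k hk _ (le_preimage_left_of_eq_inf (cechOpen_testCover_eq P T j'' 𝓥 σ.1))]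
    rw [LinearMap.rTensor_tmul, cochainBC_tmul, cochainBC_tmul, OrderedCech.SysCochain.smul_apply',
      OrderedCech.SysCochain.smul_apply', OrderedCech.SysCochain.mapₛₗ_apply, OrderedCech.SysCochain.mapₛₗ_apply,
      pullSecLE_smul]
    change (testRingHom T' k b) • _ = _
    congr 1
    exact key (g σ)
  | add x y hx hy =>
    rw [map_add, map_add, OrderedCech.SysCochain.add_apply', hx, hy, map_add, OrderedCech.SysCochain.add_apply',
      pullSecLE_add]

end Naturality

/-! ## §5. Naturality of the kernel representation -/

section KernelNaturality

variable {K : Type u} [Field K] (P T : SchemeOver K) [IsAffine T.left]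
variable {ι : Type} [LinearOrder ι] [Fintype ι] (𝓥 : ι → (P ⊗ T).left.Opens) (L : (P ⊗ T).left.Modules)
variable (hV : ∀ s : Finset ι, s.Nonempty → IsAffineOpen (cechOpen 𝓥 s)) (hcov : ⨆ i, 𝓥 i = ⊤)
variable [IsProper P.hom] [GeometricallyIntegral P.hom] [Flat P.hom] [UniversallyOpen P.hom]
  [IsNoetherianRing Γ(T.left, ⊤)] [IsLocallyNoetherian T.left] (hL : HasRank L 1)
variable {T' T'' : SchemeOver K} [IsAffine T'.left] [IsAffine T''.left] (j' : T' ⟶ T) (j'' : T'' ⟶ T)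
  (k : T'' ⟶ T') (hk : k ≫ j' = j'')

set_option maxHeartbeats 800000 in
/-- **NATURALITY OF THE KERNEL REPRESENTATION** (Görtz–Wedhorn II, Cor. 23.135 / (23.28.5); Mumford §5): for affine
test objects `k : T'' → T'` over `T`, the square
`Γ(P × T', L') —θ'→ ker(d⁰_K ⊗ B')`, `Γ(P × T'', L'') —θ''→ ker(d⁰_K ⊗ B'')` commutes with the pull-back of
sections `η_k` on the left and `k♯ ⊗ 1` on the right. [cite: GortzWedhorn2023, Cor. 23.135 (p. 355) and (23.28.5)] -/
theorem kernelReprEquiv_natural (s : SecMod (testMod P T j' L) (baseToTotal P T') ⊤) :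
    letI := testAlgebra T j'; letI := testAlgebra T j''
    ((kernelReprEquiv P T 𝓥 L hV hcov hL j'' (pullSec P T L j' j'' k hk s) : LinearMap.ker _) :
        Γ(T''.left, ⊤) ⊗[Γ(T.left, ⊤)] (grothendieckComplex P T 𝓥 L hV hcov hL).X 0) =
      (testAlgHom T j' j'' k hk).toLinearMap.rTensor ((grothendieckComplex P T 𝓥 L hV hcov hL).X 0)
        ((kernelReprEquiv P T 𝓥 L hV hcov hL j' s : LinearMap.ker _) : Γ(T'.left, ⊤) ⊗[Γ(T.left, ⊤)] _) := by
  letI := testAlgebra T j'; letI := testAlgebra T j''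
  have hinj : ∀ v₁ v₂ : LinearMap.ker (((grothendieckComplex P T 𝓥 L hV hcov hL).d 0 1).hom.baseChange Γ(T''.left, ⊤)),
      cochainBC P T j'' 𝓥 L hV (HasRank.isFiniteLocallyFree' hL) 0
          (((grothendieckMap P T 𝓥 L hV hcov hL).f 0).hom.baseChange Γ(T''.left, ⊤) (v₁ : _)) =
        cochainBC P T j'' 𝓥 L hV (HasRank.isFiniteLocallyFree' hL) 0
          (((grothendieckMap P T 𝓥 L hV hcov hL).f 0).hom.baseChange Γ(T''.left, ⊤) (v₂ : _)) → v₁ = v₂ := by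
    intro v₁ v₂ h
    obtain ⟨x₁, rfl⟩ := (kernelReprEquiv P T 𝓥 L hV hcov hL j'').surjective v₁
    obtain ⟨x₂, rfl⟩ := (kernelReprEquiv P T 𝓥 L hV hcov hL j'').surjective v₂
    rw [cochainBC_kernelReprEquiv, cochainBC_kernelReprEquiv] at h
    rw [cechAugment_injective _ _ _ (iSup_testCover P T 𝓥 hcov j'') h]
  have hmem : (testAlgHom T j' j'' k hk).toLinearMap.rTensor ((grothendieckComplex P T 𝓥 L hV hcov hL).X 0)
      ((kernelReprEquiv P T 𝓥 L hV hcov hL j' s : LinearMap.ker _) : Γ(T'.left, ⊤) ⊗[Γ(T.left, ⊤)] _) ∈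
        LinearMap.ker (((grothendieckComplex P T 𝓥 L hV hcov hL).d 0 1).hom.baseChange Γ(T''.left, ⊤)) :=
    rTensor_mem_ker_baseChange Γ(T'.left, ⊤) (testAlgHom T j' j'' k hk) _ (kernelReprEquiv P T 𝓥 L hV hcov hL j' s).2
  suffices h : kernelReprEquiv P T 𝓥 L hV hcov hL j'' (pullSec P T L j' j'' k hk s) = ⟨_, hmem⟩ from
    congrArg Subtype.val h
  refine hinj _ _ ?_
  rw [cochainBC_kernelReprEquiv]
  change _ = cochainBC P T j'' 𝓥 L hV (HasRank.isFiniteLocallyFree' hL) 0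
    (((grothendieckMap P T 𝓥 L hV hcov hL).f 0).hom.baseChange Γ(T''.left, ⊤)
      ((testAlgHom T j' j'' k hk).toLinearMap.rTensor ((grothendieckComplex P T 𝓥 L hV hcov hL).X 0)
        ((kernelReprEquiv P T 𝓥 L hV hcov hL j' s : LinearMap.ker _) : Γ(T'.left, ⊤) ⊗[Γ(T.left, ⊤)] _)))
  have hz : ((grothendieckMap P T 𝓥 L hV hcov hL).f 0).hom.baseChange Γ(T''.left, ⊤)
      ((testAlgHom T j' j'' k hk).toLinearMap.rTensor ((grothendieckComplex P T 𝓥 L hV hcov hL).X 0)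
        ((kernelReprEquiv P T 𝓥 L hV hcov hL j' s : LinearMap.ker _) : Γ(T'.left, ⊤) ⊗[Γ(T.left, ⊤)] _)) =
      (testAlgHom T j' j'' k hk).toLinearMap.rTensor
        (OrderedCech.SysCochain (sectionsSystem 𝓥 L (baseToTotal P T)) 0)
        (((grothendieckMap P T 𝓥 L hV hcov hL).f 0).hom.baseChange Γ(T'.left, ⊤)
          ((kernelReprEquiv P T 𝓥 L hV hcov hL j' s : LinearMap.ker _) : Γ(T'.left, ⊤) ⊗[Γ(T.left, ⊤)] _)) :=
    (LinearMap.rTensor_baseChange _ _ _).symm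
  rw [hz]
  funext σ
  rw [cochainBC_rTensor, cochainBC_kernelReprEquiv, cechAugment_apply, cechAugment_apply]
  exact (pullSecLE_res P T L j' j'' k hk _ _ le_top le_top s).symm

end KernelNaturality

end Literature.AlgebraicGeometry.Modules

end
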